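/-
Copyright (c) 2026 the pub-hodgecm-mathlib formalisation cell (harness21).  Prover seat hodgecm-mathlib-K2E3-p12 (g8), Track B ∕ K2-LIT, h413 = `stmt-HodgeConjecture-24833`,
line `K2_E1_TraceFormulaBeta`, campaign «R8₂-sph EXHAUSTION», deal (69)∕(101) f3-sph «inner product formula for spherical pseudo-Eisenstein series» of the dealer K2E1-plan (g6):
FILE D0 = the toolkit of the RADIAL pseudo-Eisenstein series `θ_f = E(f∘H)` on `U(1,1)_{L∕L⁺}` (flat-section form, regularity, cusp vanishing, boundedness, Godement finiteness,
constant term), feeding FILE D `K2E1PseudoEisensteinInnerProductCMTwo` (the HEAD).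
-/
import Summits.HodgeConjecture.HodgeConjecture.Theorems.K2E1SphericalIntertwiningMellinCMTwo   -- ★ B p859488 (K2E1-p13): (GM) `∫ f(H(w₀vg)) dν = (2π)⁻¹∫ f̃·c·H^{1−z}`; transitively ★ A, the MS-TWO chain, ★ R3, reduction theory
import HarnessLib

/-!
# R8₂-sph (69) f3-sph FILE D0 — `K2E1PseudoEisensteinRadialCMTwo`: THE RADIAL PSEUDO-EISENSTEIN SERIES `θ_f(g) = Σ_{γ ∈ B(F)∖G(F)} f(H(γg))` OF `U(1,1)_{L∕L⁺}` FOR `f ∈ C_c((0,∞))`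
# — flat-section form, summability, continuity, `G(F)`-invariance, CUSP VANISHING, BOUNDEDNESS, Godement finiteness, and the CONSTANT TERM `θ_{f,B} = f∘H + (ν𝓕)⁻¹•(Mf)∘H`

Track B ∕ K2-LIT, crux h413 = `stmt-HodgeConjecture-24833`, route of record `HCCMUnconditional`; cell `hodgecm-mathlib`, squad K2, ENGINE E1.  THEOREMS ONLY (no `def`, no `instance`,
no `notation`, no named-fact hypothesis, no `sorry`; default heartbeats); lane `--supports stmt-HodgeConjecture-24833 --as helper` (count-neutral).  Convention of record = LEFT:
`θ_f := eisensteinSeriesU (fun g => f (borelHeight g))` (★ `eisensteinSeriesU f g = Σ'_{B(F)∖G(F)} f(γ g)`), `borelConstantTerm ν 𝓕 φ g = (ν𝓕)⁻¹ ∫_𝓕 φ(u g) dν`.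
THE MATHEMATICS ([MoeglinWaldspurger1995, II.1.2–II.1.4, II.1.7, I.2.13]; [Garrett2018, §1.8, §2.8–§2.11]).  For `f : ℝ → ℂ` with `tsupport f ⊆ (0,∞)` and any real `σ` the radial section
`f∘H` IS the flat section `flatSectionU φ_σ σ` of the coefficient `φ_σ(g) = H(g)^{−σ}·f(H(g))` (§1: `comp_borelHeight_eq_flatSectionU`), and for `f ∈ C_c((0,∞))` the coefficient is
CONTINUOUS, BOUNDED (a continuous compactly supported function of `H`), left-`N(𝔸)`- and left-`B(F)`-invariant.  Hence every ★ theorem of the MS-TWO chain about `E(φ·H^z)`, `Re z > 1`,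
`φ` continuous bounded, applies to `θ_f` at `z = σ = 2`: summability ★ `summable_flatSectionU_cm_two`, continuity ★ `continuous_eisensteinSeriesU_flatSectionU_cm_two`, `G(F)`-invariance
★ `eisensteinSeriesU_flatSectionU_arithmeticSubgroup_mul`, Godement finiteness in ★ R3's spelling ★ `hfin_of_locallyUniformMajorant` ∘ ★ `exists_locallyUniform_majorant_flatSectionU_cm_two`
(§2).  CUSP VANISHING (§1, any quadratic `(F,E,c)`): if `f = 0` off `(T⁻¹, T)`, `T ≥ 1`, then `θ_f(g) = 0` whenever `H(g) > T` — the Borel coset contributes `f(H g) = 0`, every other coset has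
`H(γg) ≤ H(g)⁻¹ < T⁻¹` by the rank-one big cell ★ `borelHeight_mul_borelHeight_le_one_of_not_mem_arithmeticBorel_two`.  BOUNDEDNESS (§2): reduction theory ★ `reductionTheoryU_two_antidiagonal`
(`G(𝔸) = G(L⁺)·𝔖`), the relatively compact low part of the Siegel set ★ `exists_isCompact_siegel_low_two` + continuity (★ `exists_bound_low_of_isCompact`) below `T`, cusp vanishing above `T`.
CONSTANT TERM (§2): ★ R3 `borelConstantTerm_eisensteinSeriesU_two` (`θ_{f,B} = f∘H + (ν𝓕)⁻¹ • ∫_{N(𝔸)} f(H(w₀vg)) dν`) with its `hfin` discharged, then ★ B's Mellin representation: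
**`θ_{f,B}(g) = f(H g) + (ν𝓕)⁻¹·(2π)⁻¹∫_ℝ f̃(z)·c(z)·H(g)^{1−z} dy`**, `z = σ₀ + iy`, `σ₀ > 1`, `f̃(z) = mellin f (−z)`, `c(z) = ∫_{N(𝔸)} H(w₀v)^z dν`.
* §1 (generic `(F,E,c)`): `comp_borelHeight_eq_flatSectionU`, `continuous_radialCoeff`, `exists_bound_radialCoeff`, `exists_one_le_forall_eq_zero`, `eisensteinSeriesU_comp_borelHeight_eq_zero_of_lt`,
  `norm_le_of_cover_of_eq_zero`.
* §2 (the CM pair, `N = 2`): `summable_comp_borelHeight_cm_two`, `continuous_∕measurable_eisensteinSeriesU_comp_borelHeight_cm_two`, `eisensteinSeriesU_comp_borelHeight_arithmeticSubgroup_mul`,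
  **`exists_bound_eisensteinSeriesU_comp_borelHeight_cm_two`**, `hfin_comp_borelHeight_cm_two`, **`borelConstantTerm_eisensteinSeriesU_comp_borelHeight_cm_two`**.
* §3 (generic `(F,E,c)`, every rank): `lintegral_weight_mul_conj_lt_top`, **`exists_integral_quotFun_eisensteinSeriesU_mul_conj_eq`** — `∫_X quotFun (E f)·conj (quotFun Λ′) dμ = c_μ·∫ β•(f·conj Λ′) dν_G`
  for bounded Borel left-`G(F)`-invariant `Λ′` (the untruncated twin of ★ `K2E1MaassSelbergFourBrackets` §0, through ★ BochnerFin); FILE D takes `Λ′ = θ_{f′}` (bounded by §2).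
HONEST LABEL: HC_CM is proved only modulo the 7 printed citations (2 remaining named inputs: hLiu418 = `stmt-HodgeConjecture-24832`, h413 = `stmt-HodgeConjecture-24833`) until rung 0
closes; this file asserts no named fact, closes no socket; count-neutral; letter-free (structural data `ν`, `𝓕` only).

## References
* [MoeglinWaldspurger1995] C. Mœglin, J.-L. Waldspurger, *Spectral decomposition and Eisenstein series* (1995), I.2.13, II.1.2–II.1.4, II.1.7.
* [Garrett2018] P. Garrett, *Modern Analysis of Automorphic Forms by Example* (2018), §1.8, §2.8–§2.11.
-/

set_option autoImplicit false
set_option linter.dupNamespace false  -- the mandated namespace repeats the summit's segment (`HodgeConjecture.HodgeConjecture`)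

noncomputable section

open MeasureTheory Measure Set Filter Topology Complex NumberField IsDedekindDomain MulAction
open scoped Real NNReal ENNReal ComplexConjugate Pointwise
open Literature.MeasureTheory.Group Literature.NumberTheory
open Literature.NumberTheory.Automorphic Literature.NumberTheory.Automorphic.UnitaryGroup AdelicGroupData
open Summit.HodgeConjecture.HodgeConjecture.Cruxes.H413.K2E1BorelEisensteinU
open Summit.HodgeConjecture.HodgeConjecture.Cruxes.H413.K2E1MellinPaleyWienerHalfLine (continuous_ofReal_cpow_mul)
open Summit.HodgeConjecture.HodgeConjecture.Cruxes.H413.K2E1BorelCosetsDictionary (eisensteinSeriesU_eq_tsum_arithmeticBorelQuot forall_arithmeticBorel_iff)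
open Summit.HodgeConjecture.HodgeConjecture.Cruxes.H413.K2E1MaassSelbergCMTwo (summable_flatSectionU_cm_two)
open Summit.HodgeConjecture.HodgeConjecture.Cruxes.H413.K2E1BorelEisensteinRegularU (continuous_eisensteinSeriesU_flatSectionU_cm_two)
open Summit.HodgeConjecture.HodgeConjecture.Cruxes.H413.K2E1TruncatedEisensteinBoundedCMThree (eisensteinSeriesU_flatSectionU_arithmeticSubgroup_mul)
open Summit.HodgeConjecture.HodgeConjecture.Cruxes.H413.K2E1TruncatedEisensteinBoundedCMTwo (reductionTheoryU_two_antidiagonal exists_isCompact_siegel_low_two)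
open Summit.HodgeConjecture.HodgeConjecture.Cruxes.H413.K2E1TruncatedEisensteinL2 (exists_bound_low_of_isCompact)
open Summit.HodgeConjecture.HodgeConjecture.Cruxes.H413.K2E1EisensteinAnalyticBinders (hfin_of_locallyUniformMajorant)
open Summit.HodgeConjecture.HodgeConjecture.Cruxes.H413.K2E1BorelEisensteinGodementCMTwo (exists_locallyUniform_majorant_flatSectionU_cm_two)
open Summit.HodgeConjecture.HodgeConjecture.Cruxes.H413.K2E1EisensteinSeriesLeftRight (borelConstantTerm_eisensteinSeriesU_two)
open Summit.HodgeConjecture.HodgeConjecture.Cruxes.H413.K2E1UnipotentHaarNormalisationU2 (isInvInvariant_of_isHaarMeasure_two)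
open Summit.HodgeConjecture.HodgeConjecture.Cruxes.H413.K2E1SphericalIntertwiningMellinCMTwo (integral_comp_borelHeight_weylLongU_eq_mellin_cm_two)

namespace Summit.HodgeConjecture.HodgeConjecture.Cruxes.H413.K2E1PseudoEisensteinRadialCMTwo

/-! ## §1 Generic `(F, E, c)`: the radial section as a flat section; cusp vanishing; the case split for boundedness -/

section Generic

variable {F E : Type} [Field F] [NumberField F] [Field E] [NumberField E] [Algebra F E] {c : E ≃ₐ[F] E} {N : ℕ} [NeZero N]

/-- **THE RADIAL SECTION IS A FLAT SECTION**: `f∘H = flatSectionU φ_σ σ` with `φ_σ(g) = H(g)^{−σ}·f(H(g))` (`H > 0`, `H^{−σ}·H^{σ} = 1`), every `f` and every real `σ`. [cite: MoeglinWaldspurger1995, II.1.2] -/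
theorem comp_borelHeight_eq_flatSectionU (f : ℝ → ℂ) (σ : ℝ) :
    (fun g : (quasiSplit F E c N).Adelic => f (borelHeight g : ℝ)) =
      flatSectionU (fun g : (quasiSplit F E c N).Adelic => ((borelHeight g : ℝ) : ℂ) ^ (-(σ : ℂ)) * f (borelHeight g : ℝ)) (σ : ℂ) := by
  funext g
  have hH : ((borelHeight g : ℝ) : ℂ) ≠ 0 := ofReal_ne_zero.2 (ne_of_gt (by exact_mod_cast borelHeight_pos g))
  rw [flatSectionU_apply, mul_comm (_ ^ _) (f _), mul_assoc, ← cpow_add _ _ hH, neg_add_cancel, cpow_zero, mul_one]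

/-- The radial coefficient `φ_σ = H^{−σ}·f∘H` is continuous for `f` continuous with `tsupport f ⊆ (0,∞)` (★ A `continuous_ofReal_cpow_mul` ∘ ★ `continuous_borelHeight`). [cite: MoeglinWaldspurger1995, II.1.2] -/
theorem continuous_radialCoeff {f : ℝ → ℂ} (hfc : Continuous f) (hf0 : tsupport f ⊆ Ioi 0) (σ : ℝ) :
    Continuous fun g : (quasiSplit F E c N).Adelic => ((borelHeight g : ℝ) : ℂ) ^ (-(σ : ℂ)) * f (borelHeight g : ℝ) :=
  (continuous_ofReal_cpow_mul hfc hf0 (-(σ : ℂ))).comp (NNReal.continuous_coe.comp continuous_borelHeight)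

/-- The radial coefficient `φ_σ = H^{−σ}·f∘H` is BOUNDED for `f ∈ C_c((0,∞))`: `t ↦ t^{−σ}·f(t)` is continuous on `ℝ` with compact support. [cite: MoeglinWaldspurger1995, II.1.2] -/
theorem exists_bound_radialCoeff {f : ℝ → ℂ} (hfc : Continuous f) (hfs : HasCompactSupport f) (hf0 : tsupport f ⊆ Ioi 0) (σ : ℝ) :
    ∃ C : ℝ, ∀ g : (quasiSplit F E c N).Adelic, ‖((borelHeight g : ℝ) : ℂ) ^ (-(σ : ℂ)) * f (borelHeight g : ℝ)‖ ≤ C := by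
  obtain ⟨C, hC⟩ := (continuous_ofReal_cpow_mul hfc hf0 (-(σ : ℂ))).bounded_above_of_compact_support hfs.mul_left
  exact ⟨C, fun g => hC _⟩

/-- The radial coefficient is left-`B(F)`-invariant (in the `borelU` spelling of ★ `eisensteinSeriesU`): `H(b x) = H(x)` for rational Borel `b`. [cite: Garrett2018, §2.2] -/
theorem radialCoeff_borelU_mul (f : ℝ → ℂ) (σ : ℝ) :
    ∀ b ∈ borelU (c : E →+* E) ((StdForm.antidiagonal N).over E), ∀ x : (quasiSplit F E c N).Adelic,
      (fun g : (quasiSplit F E c N).Adelic => ((borelHeight g : ℝ) : ℂ) ^ (-(σ : ℂ)) * f (borelHeight g : ℝ)) ((quasiSplit F E c N).toAdelic b * x) =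
        (fun g : (quasiSplit F E c N).Adelic => ((borelHeight g : ℝ) : ℂ) ^ (-(σ : ℂ)) * f (borelHeight g : ℝ)) x :=
  (forall_arithmeticBorel_iff (ψ := fun g : (quasiSplit F E c N).Adelic => ((borelHeight g : ℝ) : ℂ) ^ (-(σ : ℂ)) * f (borelHeight g : ℝ))).1 fun b hb x => by
    simp only [K2E1TruncatedEisensteinExplicit.borelHeight_arithmeticBorel_mul hb]

/-- `f∘H` is left-`B(F)`-invariant (arithmetic spelling). [cite: Garrett2018, §2.2] -/
theorem comp_borelHeight_arithmeticBorel_mul (f : ℝ → ℂ) :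
    ∀ b ∈ arithmeticBorel F E c N, ∀ x : (quasiSplit F E c N).Adelic,
      (fun g : (quasiSplit F E c N).Adelic => f (borelHeight g : ℝ)) ((b : (quasiSplit F E c N).Adelic) * x) = (fun g : (quasiSplit F E c N).Adelic => f (borelHeight g : ℝ)) x :=
  fun b hb x => by simp only [K2E1TruncatedEisensteinExplicit.borelHeight_arithmeticBorel_mul hb]

/-- `f∘H` is left-`B(F)`-invariant (`borelU` spelling). [cite: Garrett2018, §2.2] -/
theorem comp_borelHeight_borelU_mul (f : ℝ → ℂ) :
    ∀ b ∈ borelU (c : E →+* E) ((StdForm.antidiagonal N).over E), ∀ x : (quasiSplit F E c N).Adelic,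
      (fun g : (quasiSplit F E c N).Adelic => f (borelHeight g : ℝ)) ((quasiSplit F E c N).toAdelic b * x) = (fun g : (quasiSplit F E c N).Adelic => f (borelHeight g : ℝ)) x :=
  (forall_arithmeticBorel_iff (ψ := fun g : (quasiSplit F E c N).Adelic => f (borelHeight g : ℝ))).1 (comp_borelHeight_arithmeticBorel_mul f)

/-- `f∘H` is left-`N(𝔸)`-invariant (★ `borelHeight_unipotent_mul`). [cite: Garrett2018, §2.2] -/
theorem comp_borelHeight_unipotent_mul (f : ℝ → ℂ) (u : ↥(adelicUnipotent F E c N)) (x : (quasiSplit F E c N).Adelic) :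
    (fun g : (quasiSplit F E c N).Adelic => f (borelHeight g : ℝ)) ((u : (quasiSplit F E c N).Adelic) * x) = (fun g : (quasiSplit F E c N).Adelic => f (borelHeight g : ℝ)) x := by
  simp only [borelHeight_unipotent_mul u.2]

/-- `E(f∘H)` is left-`G(F)`-invariant (any rank; ★ `eisensteinSeriesU_flatSectionU_arithmeticSubgroup_mul` through §1's flat-section form). [cite: MoeglinWaldspurger1995, II.1.5] -/
theorem eisensteinSeriesU_comp_borelHeight_arithmeticSubgroup_mul (f : ℝ → ℂ) (γ : (quasiSplit F E c N).arithmeticSubgroup) (g : (quasiSplit F E c N).Adelic) :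
    eisensteinSeriesU (fun x : (quasiSplit F E c N).Adelic => f (borelHeight x : ℝ)) ((γ : (quasiSplit F E c N).Adelic) * g) =
      eisensteinSeriesU (fun x : (quasiSplit F E c N).Adelic => f (borelHeight x : ℝ)) g := by
  rw [comp_borelHeight_eq_flatSectionU f 2]
  exact eisensteinSeriesU_flatSectionU_arithmeticSubgroup_mul (φ := fun g : (quasiSplit F E c N).Adelic => ((borelHeight g : ℝ) : ℂ) ^ (-((2 : ℝ) : ℂ)) * f (borelHeight g : ℝ))
    (radialCoeff_borelU_mul f 2) _ γ g

/-- **A COMPACT SUBSET OF `(0,∞)` LIES IN SOME `(T⁻¹, T)`, `T ≥ 1`**: for `f` with compact support in `(0,∞)` there is `T ≥ 1` with `f(r) = 0` whenever `r > T` or `r < T⁻¹`. [folklore] -/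
theorem exists_one_le_forall_eq_zero {f : ℝ → ℂ} (hfs : HasCompactSupport f) (hf0 : tsupport f ⊆ Ioi 0) :
    ∃ T : ℝ≥0, 1 ≤ T ∧ (∀ r : ℝ, (T : ℝ) < r → f r = 0) ∧ ∀ r : ℝ, r < (T : ℝ)⁻¹ → f r = 0 := by
  obtain ⟨R, hR⟩ := hfs.isCompact.bddAbove
  have hlow : ∃ a : ℝ, 0 < a ∧ ∀ r ∈ tsupport f, a ≤ r := by
    by_cases hne : (tsupport f).Nonempty
    · obtain ⟨r₀, hr₀, hmin⟩ := hfs.isCompact.exists_isMinOn hne continuous_id.continuousOn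
      exact ⟨r₀, hf0 hr₀, fun r hr => hmin hr⟩
    · exact ⟨1, one_pos, fun r hr => (hne ⟨r, hr⟩).elim⟩
  obtain ⟨a, ha, hale⟩ := hlow
  set T₀ : ℝ := max (max 1 (R + 1)) (a⁻¹ + 1) with hT₀
  have hT₀1 : 1 ≤ T₀ := (le_max_left _ _).trans (le_max_left _ _)
  have hT₀pos : 0 < T₀ := one_pos.trans_le hT₀1
  refine ⟨⟨T₀, hT₀pos.le⟩, hT₀1, fun r hr => ?_, fun r hr => ?_⟩
  · refine image_eq_zero_of_notMem_tsupport fun hmem => ?_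
    have h1 : R + 1 ≤ T₀ := (le_max_right _ _).trans (le_max_left _ _)
    have h2 : r ≤ R := hR hmem
    exact absurd (show (T₀ : ℝ) < r from hr) (not_lt.2 (by linarith))
  · refine image_eq_zero_of_notMem_tsupport fun hmem => ?_
    have h1 : a⁻¹ < T₀ := (lt_add_one _).trans_le (le_max_right _ _)
    have h2 : (T₀ : ℝ)⁻¹ < a := by rw [inv_lt_comm₀ hT₀pos ha]; exact h1
    exact absurd ((show r < (T₀ : ℝ)⁻¹ from hr).trans h2) (not_lt.2 (hale r hmem))

/-- **CUSP VANISHING OF `θ_f` ON `U(J₂)`** (any quadratic `(F,E,c)`): if `f(r) = 0` for `r > T` and for `r < T⁻¹` (`T ≥ 1`), then `θ_f(g) = 0` whenever `H(g) > T` — the Borel coset gives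
`f(H g) = 0`, and for `γ ∉ B(F)` the rank-one big cell ★ `borelHeight_mul_borelHeight_le_one_of_not_mem_arithmeticBorel_two` gives `H(γg) ≤ H(g)⁻¹ < T⁻¹`. [cite: Garrett2018, §1.8 and §2.3]
[cite: MoeglinWaldspurger1995, II.1.2] -/
theorem eisensteinSeriesU_comp_borelHeight_eq_zero_of_lt {f : ℝ → ℂ} {T : ℝ≥0} (hT : 1 ≤ T) (hhi : ∀ r : ℝ, (T : ℝ) < r → f r = 0) (hlo : ∀ r : ℝ, r < (T : ℝ)⁻¹ → f r = 0)
    {g : (quasiSplit F E c 2).Adelic} (hg : T < borelHeight g) :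
    eisensteinSeriesU (fun x : (quasiSplit F E c 2).Adelic => f (borelHeight x : ℝ)) g = 0 := by
  rw [eisensteinSeriesU_eq_tsum_arithmeticBorelQuot (comp_borelHeight_arithmeticBorel_mul f) g]
  have hT0 : (0 : ℝ≥0) < T := one_pos.trans_le hT
  have hg0 : (0 : ℝ≥0) < borelHeight g := hT0.trans hg
  have h0 : ∀ q : Quotient (QuotientGroup.rightRel (arithmeticBorel F E c 2)),
      f (borelHeight (((q.out : (quasiSplit F E c 2).arithmeticSubgroup) : (quasiSplit F E c 2).Adelic) * g) : ℝ) = 0 := by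
    intro q
    by_cases hq : q.out ∈ arithmeticBorel F E c 2
    · rw [K2E1TruncatedEisensteinExplicit.borelHeight_arithmeticBorel_mul hq]
      exact hhi _ (by exact_mod_cast hg)
    · refine hlo _ ?_
      have h1 := borelHeight_mul_borelHeight_le_one_of_not_mem_arithmeticBorel_two hq g
      have h2 : borelHeight (((q.out : (quasiSplit F E c 2).arithmeticSubgroup) : (quasiSplit F E c 2).Adelic) * g) ≤ (borelHeight g)⁻¹ :=
        (NNReal.le_inv_iff_mul_le hg0.ne').2 h1
      have h3 : ((borelHeight g)⁻¹ : ℝ≥0) < T⁻¹ := inv_strictAnti₀ hT0 hg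
      exact_mod_cast h2.trans_lt h3
  simp only [h0, tsum_zero]

/-- **THE CASE SPLIT FOR BOUNDEDNESS** (any rank, no topology): `G(F)·𝔖 = G(𝔸)`, `φ` left-`G(F)`-invariant, `‖φ‖ ≤ M₀` on `𝔖 ∩ {H ≤ T}`, `φ = 0` on `{H > T}` ⟹ `‖φ‖ ≤ max M₀ 0` on `G(𝔸)` — the
pattern of ★ `norm_truncation_le_of_cover`. [cite: MoeglinWaldspurger1995, I.2.13] [cite: Garrett2018, §2.10–§2.11] -/
theorem norm_le_of_cover_of_eq_zero {φ : (quasiSplit F E c N).Adelic → ℂ} {𝔖 : Set (quasiSplit F E c N).Adelic} {T : ℝ≥0} {M₀ : ℝ}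
    (hcov : ((quasiSplit F E c N).arithmeticSubgroup : Set (quasiSplit F E c N).Adelic) * 𝔖 = Set.univ)
    (hinv : ∀ (γ : (quasiSplit F E c N).arithmeticSubgroup) (g : (quasiSplit F E c N).Adelic), φ ((γ : (quasiSplit F E c N).Adelic) * g) = φ g)
    (hlow : ∀ s ∈ 𝔖, borelHeight s ≤ T → ‖φ s‖ ≤ M₀) (hhigh : ∀ g : (quasiSplit F E c N).Adelic, T < borelHeight g → φ g = 0)
    (g : (quasiSplit F E c N).Adelic) : ‖φ g‖ ≤ max M₀ 0 := by
  have hg : g ∈ ((quasiSplit F E c N).arithmeticSubgroup : Set (quasiSplit F E c N).Adelic) * 𝔖 := by rw [hcov]; exact Set.mem_univ g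
  obtain ⟨γ, hγ, s, hs, rfl⟩ := Set.mem_mul.1 hg
  rw [show γ * s = ((⟨γ, hγ⟩ : (quasiSplit F E c N).arithmeticSubgroup) : (quasiSplit F E c N).Adelic) * s from rfl, hinv]
  by_cases hex : ∃ δ : (quasiSplit F E c N).arithmeticSubgroup, T < borelHeight ((δ : (quasiSplit F E c N).Adelic) * s)
  · obtain ⟨δ, hδ⟩ := hex
    rw [← hinv δ s, hhigh _ hδ, norm_zero]
    exact le_max_right _ _
  · push Not at hex
    have hsT : borelHeight s ≤ T := by simpa using hex 1
    exact (hlow s hs hsT).trans (le_max_left _ _)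

end Generic

/-! ## §2 The CM pair `(L⁺, L, conj)`, `N = 2`: summability, continuity, boundedness, Godement finiteness, the constant term of `θ_f` -/

section CM

variable (L : Type) [Field L] [NumberField L] [IsCMField L]
variable [MeasurableSpace (quasiSplit (↥(maximalRealSubfield L)) L (IsCMField.complexConj L) 2).Adelic] [BorelSpace (quasiSplit (↥(maximalRealSubfield L)) L (IsCMField.complexConj L) 2).Adelic]

omit [MeasurableSpace (quasiSplit (↥(maximalRealSubfield L)) L (IsCMField.complexConj L) 2).Adelic] [BorelSpace (quasiSplit (↥(maximalRealSubfield L)) L (IsCMField.complexConj L) 2).Adelic] in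
/-- **`Σ_{γ ∈ B(F)∖G(F)} f(H(γ g))` CONVERGES ABSOLUTELY** for `f ∈ C_c((0,∞))` (★ `summable_flatSectionU_cm_two` at `z = 2` through §1's flat-section form). [cite: MoeglinWaldspurger1995, II.1.2 and II.1.5] -/
theorem summable_comp_borelHeight_cm_two {f : ℝ → ℂ} (hfc : Continuous f) (hfs : HasCompactSupport f) (hf0 : tsupport f ⊆ Ioi 0)
    (g : (quasiSplit (↥(maximalRealSubfield L)) L (IsCMField.complexConj L) 2).Adelic) :
    Summable fun q : Quotient (orbitRel ↥(borelU ((IsCMField.complexConj L : L ≃ₐ[↥(maximalRealSubfield L)] L) : L →+* L) ((StdForm.antidiagonal 2).over L))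
        ↥(unitaryGroupOfForm ((IsCMField.complexConj L : L ≃ₐ[↥(maximalRealSubfield L)] L) : L →+* L) ((StdForm.antidiagonal 2).over L))) =>
      f (borelHeight ((quasiSplit (↥(maximalRealSubfield L)) L (IsCMField.complexConj L) 2).toAdelic
          (Quotient.out q : ↥(unitaryGroupOfForm ((IsCMField.complexConj L : L ≃ₐ[↥(maximalRealSubfield L)] L) : L →+* L) ((StdForm.antidiagonal 2).over L))) * g) : ℝ) := by
  set φ : (quasiSplit (↥(maximalRealSubfield L)) L (IsCMField.complexConj L) 2).Adelic → ℂ := fun x => ((borelHeight x : ℝ) : ℂ) ^ (-((2 : ℝ) : ℂ)) * f (borelHeight x : ℝ) with hφ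
  obtain ⟨C, hC⟩ := exists_bound_radialCoeff (F := ↥(maximalRealSubfield L)) (E := L) (c := IsCMField.complexConj L) (N := 2) hfc hfs hf0 2
  have hE : ∀ x, f (borelHeight x : ℝ) = flatSectionU φ ((2 : ℝ) : ℂ) x := fun x => congrFun (comp_borelHeight_eq_flatSectionU f 2) x
  have h2 : 1 < (((2 : ℝ) : ℂ)).re := by rw [ofReal_re]; norm_num
  have h := summable_flatSectionU_cm_two L h2 (φ := φ) hC g
  simp only [← hE] at h
  exact h

omit [MeasurableSpace (quasiSplit (↥(maximalRealSubfield L)) L (IsCMField.complexConj L) 2).Adelic] [BorelSpace (quasiSplit (↥(maximalRealSubfield L)) L (IsCMField.complexConj L) 2).Adelic] in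
/-- **`θ_f` IS CONTINUOUS on `U(1,1)(𝔸_{L⁺})`** for `f ∈ C_c((0,∞))` (★ R4a `continuous_eisensteinSeriesU_flatSectionU_cm_two` at `z = 2`). [cite: MoeglinWaldspurger1995, II.1.5] [cite: Garrett2018, §2.8] -/
theorem continuous_eisensteinSeriesU_comp_borelHeight_cm_two {f : ℝ → ℂ} (hfc : Continuous f) (hfs : HasCompactSupport f) (hf0 : tsupport f ⊆ Ioi 0) :
    Continuous (eisensteinSeriesU (fun x : (quasiSplit (↥(maximalRealSubfield L)) L (IsCMField.complexConj L) 2).Adelic => f (borelHeight x : ℝ))) := by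
  obtain ⟨C, hC⟩ := exists_bound_radialCoeff (F := ↥(maximalRealSubfield L)) (E := L) (c := IsCMField.complexConj L) (N := 2) hfc hfs hf0 2
  have h2 : 1 < (((2 : ℝ) : ℂ)).re := by rw [ofReal_re]; norm_num
  rw [comp_borelHeight_eq_flatSectionU f 2]
  exact continuous_eisensteinSeriesU_flatSectionU_cm_two L h2 (continuous_radialCoeff hfc hf0 2) hC

/-- `θ_f` is Borel on `U(1,1)(𝔸_{L⁺})` for `f ∈ C_c((0,∞))`. [cite: MoeglinWaldspurger1995, II.1.5] -/
theorem measurable_eisensteinSeriesU_comp_borelHeight_cm_two {f : ℝ → ℂ} (hfc : Continuous f) (hfs : HasCompactSupport f) (hf0 : tsupport f ⊆ Ioi 0) :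
    Measurable (eisensteinSeriesU (fun x : (quasiSplit (↥(maximalRealSubfield L)) L (IsCMField.complexConj L) 2).Adelic => f (borelHeight x : ℝ))) :=
  (continuous_eisensteinSeriesU_comp_borelHeight_cm_two L hfc hfs hf0).measurable

omit [MeasurableSpace (quasiSplit (↥(maximalRealSubfield L)) L (IsCMField.complexConj L) 2).Adelic] [BorelSpace (quasiSplit (↥(maximalRealSubfield L)) L (IsCMField.complexConj L) 2).Adelic] in
/-- **`θ_f` IS BOUNDED ON `U(1,1)(𝔸_{L⁺})`** for `f ∈ C_c((0,∞))`: reduction theory ★ `reductionTheoryU_two_antidiagonal` (`G(𝔸) = G(L⁺)·𝔖`), the compact low part of the Siegel set ★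
`exists_isCompact_siegel_low_two` + continuity of `θ_f` (★ `exists_bound_low_of_isCompact`) below the cut-off `T` of `exists_one_le_forall_eq_zero`, CUSP VANISHING
(`eisensteinSeriesU_comp_borelHeight_eq_zero_of_lt`) above it, `G(L⁺)`-invariance, and §1's case split. [cite: MoeglinWaldspurger1995, I.2.13 and II.1.2] [cite: Garrett2018, §1.8 and §2.10–§2.11] -/
theorem exists_bound_eisensteinSeriesU_comp_borelHeight_cm_two {f : ℝ → ℂ} (hfc : Continuous f) (hfs : HasCompactSupport f) (hf0 : tsupport f ⊆ Ioi 0) :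
    ∃ M : ℝ, ∀ g : (quasiSplit (↥(maximalRealSubfield L)) L (IsCMField.complexConj L) 2).Adelic,
      ‖eisensteinSeriesU (fun x : (quasiSplit (↥(maximalRealSubfield L)) L (IsCMField.complexConj L) 2).Adelic => f (borelHeight x : ℝ)) g‖ ≤ M := by
  obtain ⟨T, hT, hhi, hlo⟩ := exists_one_le_forall_eq_zero hfs hf0
  obtain ⟨S, ⟨Ω, K, t, ht, hΩ, hΩc, hKc, rfl⟩, hcov⟩ := reductionTheoryU_two_antidiagonal L
  obtain ⟨C, hC, hsub⟩ := exists_isCompact_siegel_low_two (exists_mem_borelAdelic_mul_mem_standardMaximalCompactGL_cm L) ht hΩ hΩc hKc T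
  obtain ⟨M₀, hlow⟩ := exists_bound_low_of_isCompact hC hsub (continuous_eisensteinSeriesU_comp_borelHeight_cm_two L hfc hfs hf0).continuousOn
  exact ⟨max M₀ 0, norm_le_of_cover_of_eq_zero hcov (eisensteinSeriesU_comp_borelHeight_arithmeticSubgroup_mul f) hlow
    (fun g hg => eisensteinSeriesU_comp_borelHeight_eq_zero_of_lt hT hhi hlo hg)⟩

/-- **GODEMENT FINITENESS OF THE RADIAL SECTION IN ★ R3's SPELLING** (`∫⁻_{u∈𝓕} Σ_{p ∈ Γ⧸B_Γ} ‖f(H(p̃⁻¹ u g))‖ dν < ∞`, `𝓕` of compact closure): ★ `hfin_of_locallyUniformMajorant` with the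
locally uniform summable majorant ★ `exists_locallyUniform_majorant_flatSectionU_cm_two` of the flat section `φ_2·H^2`. [cite: MoeglinWaldspurger1995, II.1.5] [cite: Godement1964, §8] -/
theorem hfin_comp_borelHeight_cm_two (ν : Measure ↥(adelicUnipotent (↥(maximalRealSubfield L)) L (IsCMField.complexConj L) 2)) [ν.IsHaarMeasure]
    {𝓕 : Set ↥(adelicUnipotent (↥(maximalRealSubfield L)) L (IsCMField.complexConj L) 2)} (h𝓕c : IsCompact (closure 𝓕))
    {f : ℝ → ℂ} (hfc : Continuous f) (hfs : HasCompactSupport f) (hf0 : tsupport f ⊆ Ioi 0) (g : (quasiSplit (↥(maximalRealSubfield L)) L (IsCMField.complexConj L) 2).Adelic) :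
    ∫⁻ u in 𝓕, (∑' p : (quasiSplit (↥(maximalRealSubfield L)) L (IsCMField.complexConj L) 2).quotientSubgroup ⧸ (borelAdelic (↥(maximalRealSubfield L)) L (IsCMField.complexConj L) 2).subgroupOf (quasiSplit (↥(maximalRealSubfield L)) L (IsCMField.complexConj L) 2).quotientSubgroup,
        ‖f (borelHeight ((((p.out : (quasiSplit (↥(maximalRealSubfield L)) L (IsCMField.complexConj L) 2).quotientSubgroup) : (quasiSplit (↥(maximalRealSubfield L)) L (IsCMField.complexConj L) 2).Adelic))⁻¹ * (u : (quasiSplit (↥(maximalRealSubfield L)) L (IsCMField.complexConj L) 2).Adelic) * g) : ℝ)‖ₑ) ∂ν < ∞ := by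
  haveI := locallyCompactSpace_adeleRing' L
  set φ : (quasiSplit (↥(maximalRealSubfield L)) L (IsCMField.complexConj L) 2).Adelic → ℂ := fun x => ((borelHeight x : ℝ) : ℂ) ^ (-((2 : ℝ) : ℂ)) * f (borelHeight x : ℝ) with hφ
  obtain ⟨C, hC⟩ := exists_bound_radialCoeff (F := ↥(maximalRealSubfield L)) (E := L) (c := IsCMField.complexConj L) (N := 2) hfc hfs hf0 2
  have hE : ∀ x, f (borelHeight x : ℝ) = flatSectionU φ ((2 : ℝ) : ℂ) x := fun x => congrFun (comp_borelHeight_eq_flatSectionU f 2) x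
  have h2 : 1 < (((2 : ℝ) : ℂ)).re := by rw [ofReal_re]; norm_num
  have hB : ∀ b ∈ borelU ((IsCMField.complexConj L : L ≃ₐ[↥(maximalRealSubfield L)] L) : L →+* L) ((StdForm.antidiagonal 2).over L), ∀ x : (quasiSplit (↥(maximalRealSubfield L)) L (IsCMField.complexConj L) 2).Adelic,
      flatSectionU φ ((2 : ℝ) : ℂ) ((quasiSplit (↥(maximalRealSubfield L)) L (IsCMField.complexConj L) 2).toAdelic b * x) = flatSectionU φ ((2 : ℝ) : ℂ) x := fun b hb x => by
    rw [← hE, ← hE]; exact comp_borelHeight_borelU_mul f b hb x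
  have h := hfin_of_locallyUniformMajorant ν (f := flatSectionU φ ((2 : ℝ) : ℂ)) hB (fun q => (continuous_flatSectionU (continuous_radialCoeff hfc hf0 2) _).comp (continuous_const.mul continuous_id))
    (exists_locallyUniform_majorant_flatSectionU_cm_two L h2 hC) h𝓕c g
  simp only [← hE] at h
  exact h

/-- **THE CONSTANT TERM OF THE RADIAL PSEUDO-EISENSTEIN SERIES, MELLIN FORM**: for a Haar measure `ν` on `N(𝔸_{L⁺})`, a fundamental domain `𝓕` of `N(L⁺)` with compact closure and `ν𝓕 ≠ 0`,
`f ∈ C²_c((0,∞))`, `σ₀ > 1` and every `g`: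
**`θ_{f,B}(g) = f(H g) + (ν𝓕)⁻¹·(2π)⁻¹ ∫_ℝ f̃(σ₀+iy)·c(σ₀+iy)·H(g)^{1−(σ₀+iy)} dy`**, `f̃(z) = mellin f (−z)`, `c(z) = ∫_{N(𝔸)} H(w₀v)^z dν` — ★ R3 `borelConstantTerm_eisensteinSeriesU_two` (its `hfin` = §2's
`hfin_comp_borelHeight_cm_two`, `[ν.IsInvInvariant]` = ★ `isInvInvariant_of_isHaarMeasure_two`) followed by ★ B `integral_comp_borelHeight_weylLongU_eq_mellin_cm_two`.
[cite: MoeglinWaldspurger1995, II.1.4 and II.1.7] [cite: Garrett2018, §2.8] -/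
theorem borelConstantTerm_eisensteinSeriesU_comp_borelHeight_cm_two (ν : Measure ↥(adelicUnipotent (↥(maximalRealSubfield L)) L (IsCMField.complexConj L) 2)) [ν.IsHaarMeasure]
    {𝓕 : Set ↥(adelicUnipotent (↥(maximalRealSubfield L)) L (IsCMField.complexConj L) 2)}
    (h𝓕N : IsFundamentalDomain ↥(rationalUnipotent (↥(maximalRealSubfield L)) L (IsCMField.complexConj L) 2) 𝓕 ν) (h𝓕c : IsCompact (closure 𝓕)) (h𝓕₀ : ν 𝓕 ≠ 0)
    {f : ℝ → ℂ} (hf : ContDiff ℝ 2 f) (hfs : HasCompactSupport f) (hf0 : tsupport f ⊆ Ioi 0) {σ₀ : ℝ} (hσ₀ : 1 < σ₀) (g : (quasiSplit (↥(maximalRealSubfield L)) L (IsCMField.complexConj L) 2).Adelic) :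
    borelConstantTerm ν 𝓕 (eisensteinSeriesU (fun x : (quasiSplit (↥(maximalRealSubfield L)) L (IsCMField.complexConj L) 2).Adelic => f (borelHeight x : ℝ))) g =
      f (borelHeight g : ℝ) + (((ν 𝓕).toReal⁻¹ : ℝ) : ℂ) * ((((2 * π)⁻¹ : ℝ) : ℂ) * ∫ y : ℝ, mellin f (-((σ₀ : ℂ) + y * I)) *
        (∫ v : ↥(adelicUnipotent (↥(maximalRealSubfield L)) L (IsCMField.complexConj L) 2), (((borelHeight ((quasiSplit (↥(maximalRealSubfield L)) L (IsCMField.complexConj L) 2).toAdelic (weylLongU ((IsCMField.complexConj L : L ≃ₐ[↥(maximalRealSubfield L)] L) : L →+* L) (rfl : (StdForm.antidiagonal 2).over L = (StdForm.antidiagonal 2).over L)) * (v : (quasiSplit (↥(maximalRealSubfield L)) L (IsCMField.complexConj L) 2).Adelic))) : ℝ) : ℂ) ^ (((σ₀ : ℂ) + y * I)) ∂ν) *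
          (((borelHeight g : ℝ)) : ℂ) ^ (1 - ((σ₀ : ℂ) + y * I))) := by
  haveI := locallyCompactSpace_adeleRing' L
  haveI : ν.IsInvInvariant := isInvInvariant_of_isHaarMeasure_two ν
  have h𝓕top : ν 𝓕 ≠ ∞ := ((measure_mono subset_closure).trans_lt h𝓕c.measure_lt_top).ne
  have hfm : Measurable (fun x : (quasiSplit (↥(maximalRealSubfield L)) L (IsCMField.complexConj L) 2).Adelic => f (borelHeight x : ℝ)) :=
    (hf.continuous.comp (NNReal.continuous_coe.comp continuous_borelHeight)).measurable
  rw [borelConstantTerm_eisensteinSeriesU_two ν (f := fun x : (quasiSplit (↥(maximalRealSubfield L)) L (IsCMField.complexConj L) 2).Adelic => f (borelHeight x : ℝ)) hfm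
    (comp_borelHeight_unipotent_mul f) (comp_borelHeight_borelU_mul f) h𝓕N h𝓕₀ h𝓕top g (hfin_comp_borelHeight_cm_two L ν h𝓕c hf.continuous hfs hf0 g)]
  have hw : ∀ v : ↥(adelicUnipotent (↥(maximalRealSubfield L)) L (IsCMField.complexConj L) 2),
      (quasiSplit (↥(maximalRealSubfield L)) L (IsCMField.complexConj L) 2).toAdelic (weylLongU ((IsCMField.complexConj L : L ≃ₐ[↥(maximalRealSubfield L)] L) : L →+* L) (rfl : (StdForm.antidiagonal 2).over L = (StdForm.antidiagonal 2).over L)) * (v : (quasiSplit (↥(maximalRealSubfield L)) L (IsCMField.complexConj L) 2).Adelic) * g =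
        (quasiSplit (↥(maximalRealSubfield L)) L (IsCMField.complexConj L) 2).toAdelic (weylLongU ((IsCMField.complexConj L : L ≃ₐ[↥(maximalRealSubfield L)] L) : L →+* L) (rfl : (StdForm.antidiagonal 2).over L = (StdForm.antidiagonal 2).over L)) * ((v : (quasiSplit (↥(maximalRealSubfield L)) L (IsCMField.complexConj L) 2).Adelic) * g) :=
    fun v => mul_assoc _ _ _
  simp only [hw]
  rw [integral_comp_borelHeight_weylLongU_eq_mellin_cm_two L ν h𝓕N h𝓕c hf hfs hf0 hσ₀ g, Complex.real_smul]

end CM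

/-! ## §3 Unfolding `⟨E(f), Λ′⟩_X` to the `B(F)`-weight level for a bounded left-`G(F)`-invariant `Λ′` (generic `(F,E,c)`, every rank) -/

section Unfold

variable {F E : Type} [Field F] [NumberField F] [Field E] [NumberField E] [Algebra F E] {c : E ≃ₐ[F] E} {N : ℕ}
variable [MeasurableSpace (quasiSplit F E c N).Adelic]

/-- `∫⁻ β·‖ψ · conj Λ′‖ ≤ (∫⁻ β·‖ψ‖)·M₁ < ∞` when `‖Λ′‖ ≤ M₁` and `∫⁻ β·‖ψ‖ < ∞` (the `L¹` input of ★ BochnerFin and of ★ hAVG). [folklore] -/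
theorem lintegral_weight_mul_conj_lt_top (νG : Measure (quasiSplit F E c N).Adelic) (β : (quasiSplit F E c N).Adelic → ℝ≥0∞) {ψ Λ' : (quasiSplit F E c N).Adelic → ℂ}
    {M₁ : ℝ} (hΛbdd : ∀ g, ‖Λ' g‖ ≤ M₁) (hL1 : ∫⁻ g, β g * ‖ψ g‖ₑ ∂νG < ∞) :
    ∫⁻ g, β g * ‖ψ g * conj (Λ' g)‖ₑ ∂νG < ∞ := by
  have hM : ∀ g, ‖conj (Λ' g)‖ₑ ≤ ENNReal.ofReal M₁ := fun g => by
    rw [← ofReal_norm, Complex.norm_conj]; exact ENNReal.ofReal_le_ofReal (hΛbdd g)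
  calc ∫⁻ g, β g * ‖ψ g * conj (Λ' g)‖ₑ ∂νG
      ≤ ∫⁻ g, β g * ‖ψ g‖ₑ * ENNReal.ofReal M₁ ∂νG := lintegral_mono fun g => by rw [enorm_mul, ← mul_assoc]; gcongr; exact hM g
    _ = (∫⁻ g, β g * ‖ψ g‖ₑ ∂νG) * ENNReal.ofReal M₁ := lintegral_mul_const' _ _ ENNReal.ofReal_ne_top
    _ < ∞ := ENNReal.mul_lt_top hL1 ENNReal.ofReal_lt_top

variable [BorelSpace (quasiSplit F E c N).Adelic]

/-- **FROM `X = G(𝔸)∕G(F)` TO THE `B(F)`-WEIGHT LEVEL FOR THE PAIRING OF AN EISENSTEIN∕PSEUDO-EISENSTEIN SERIES WITH A BOUNDED AUTOMORPHIC FUNCTION** (`U(J_N)`, every `N`; the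
untruncated twin of ★ `K2E1MaassSelbergFourBrackets.exists_integral_quotFun_truncation_mul_conj_eq_mul_integral_weight`).  `μ` automorphic on `X`, `ν_G` an inversion-invariant Haar measure
on `G(𝔸)`: there is ONE `c_μ > 0` (Weil's ★ `unfoldingConstant`) such that for every covering weight `β` of `B(F)♯`, every Borel left-`B(F)`-invariant `f` with `∫⁻ β‖f‖ dν_G < ∞` and every
BOUNDED Borel left-`G(F)`-invariant `Λ′`: `x ↦ E(f)(x̃⁻¹)·conj Λ′(x̃⁻¹)` is `μ`-integrable and **`∫_X quotFun (E f)·conj (quotFun Λ′) dμ = c_μ · ∫_{G(𝔸)} β(g) • (f(g)·conj Λ′(g)) dν_G`** —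
`E(f)(g)·conj Λ′(g) = Σ'_q (f·conj Λ′)(q̃ g)` (Track A's index ★ `eisensteinSeriesU_eq_tsum_arithmeticBorelQuot`, Mathlib `tsum_mul_right`, `G(F)`-invariance of `Λ′`) and ★ BochnerFin
`integrable_tsum_borelQuotient_and_integral_eq_mul_integral_fin`. [cite: MoeglinWaldspurger1995, II.1.3 and IV.2.1] [cite: Garrett2018, §1.8 and §1.11] -/
theorem exists_integral_quotFun_eisensteinSeriesU_mul_conj_eq
    (μ : Measure (quasiSplit F E c N).automorphicQuotient) [(quasiSplit F E c N).IsAutomorphicMeasure μ]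
    (νG : Measure (quasiSplit F E c N).Adelic) [νG.IsHaarMeasure] [νG.IsInvInvariant] :
    ∃ cμ : ℝ, 0 < cμ ∧
      ∀ {β : (quasiSplit F E c N).Adelic → ℝ≥0∞}, IsCoveringWeight ((arithmeticBorel F E c N).map (quasiSplit F E c N).arithmeticSubgroup.subtype) β →
      ∀ {f Λ' : (quasiSplit F E c N).Adelic → ℂ}, Measurable f →
        (∀ b ∈ arithmeticBorel F E c N, ∀ x : (quasiSplit F E c N).Adelic, f ((b : (quasiSplit F E c N).Adelic) * x) = f x) →
        Measurable Λ' → (∀ (γ : (quasiSplit F E c N).arithmeticSubgroup) (x : (quasiSplit F E c N).Adelic), Λ' ((γ : (quasiSplit F E c N).Adelic) * x) = Λ' x) →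
        ∀ {M₁ : ℝ}, (∀ g, ‖Λ' g‖ ≤ M₁) → ∫⁻ g, β g * ‖f g‖ₑ ∂νG < ∞ →
        Integrable (fun x : (quasiSplit F E c N).automorphicQuotient => (quasiSplit F E c N).quotFun (eisensteinSeriesU f) x * conj ((quasiSplit F E c N).quotFun Λ' x)) μ ∧
          ∫ x, (quasiSplit F E c N).quotFun (eisensteinSeriesU f) x * conj ((quasiSplit F E c N).quotFun Λ' x) ∂μ =
            (cμ : ℂ) * ∫ g, (β g).toReal • (f g * conj (Λ' g)) ∂νG := by
  classical
  haveI := t2Space_adeleRing_of_numberField E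
  haveI := locallyCompactSpace_adeleRing' E
  haveI := secondCountableTopology_adeleRing E
  haveI : T2Space (quasiSplit F E c N).Adelic := inferInstanceAs (T2Space (adelic F E c N ((StdForm.antidiagonal N).over E)))
  haveI : LocallyCompactSpace (quasiSplit F E c N).Adelic := inferInstanceAs (LocallyCompactSpace (adelic F E c N ((StdForm.antidiagonal N).over E)))
  haveI : SecondCountableTopology (quasiSplit F E c N).Adelic := inferInstanceAs (SecondCountableTopology (adelic F E c N ((StdForm.antidiagonal N).over E)))
  haveI : DiscreteTopology (quasiSplit F E c N).quotientSubgroup := discreteTopology_quotientSubgroup_quasiSplit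
  haveI : Countable (quasiSplit F E c N).quotientSubgroup := by
    rw [quotientSubgroup_quasiSplit]; exact countable_arithmeticSubgroup_quasiSplit
  haveI : (count : Measure (quasiSplit F E c N).quotientSubgroup).IsHaarMeasure := isHaarMeasure_count_quotientSubgroup_quasiSplit
  letI := AdelicGroupData.measurableSpaceQuotientForm (quasiSplit F E c N)
  haveI := AdelicGroupData.borelSpaceQuotientForm (quasiSplit F E c N)
  haveI := AdelicGroupData.smulInvariantMeasureQuotientForm (quasiSplit F E c N) μ
  haveI := AdelicGroupData.isFiniteMeasureOnCompactsQuotientForm (quasiSplit F E c N) μ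
  have hcμ : 0 < unfoldingConstant (quasiSplit F E c N).quotientSubgroup (count : Measure (quasiSplit F E c N).quotientSubgroup) μ νG :=
    AdelicGroupData.unfoldingConstant_pos_of_isAutomorphicMeasure _ isClosed_quotientSubgroup_quasiSplit count μ νG
  refine ⟨(unfoldingConstant (quasiSplit F E c N).quotientSubgroup (count : Measure (quasiSplit F E c N).quotientSubgroup) μ νG : ℝ), NNReal.coe_pos.2 hcμ,
    fun {β} hβ {f} {Λ'} hfm hf hΛm hΛG {M₁} hΛbdd hL1 => ?_⟩
  have hΨm : Measurable fun g => f g * conj (Λ' g) := hfm.mul (Complex.continuous_conj.measurable.comp hΛm)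
  have hΨB : ∀ b ∈ arithmeticBorel F E c N, ∀ x : (quasiSplit F E c N).Adelic,
      f ((b : (quasiSplit F E c N).Adelic) * x) * conj (Λ' ((b : (quasiSplit F E c N).Adelic) * x)) = f x * conj (Λ' x) := fun b hb x => by rw [hf b hb x, hΛG b x]
  obtain ⟨hI, hE⟩ := integrable_tsum_borelQuotient_and_integral_eq_mul_integral_fin μ νG hβ hΨm hΨB (lintegral_weight_mul_conj_lt_top νG β hΛbdd hL1)
  have hpt : ∀ g : (quasiSplit F E c N).Adelic, eisensteinSeriesU f g * conj (Λ' g) =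
      ∑' q : Quotient (QuotientGroup.rightRel (arithmeticBorel F E c N)),
        f (((q.out : (quasiSplit F E c N).arithmeticSubgroup) : (quasiSplit F E c N).Adelic) * g) * conj (Λ' (((q.out : (quasiSplit F E c N).arithmeticSubgroup) : (quasiSplit F E c N).Adelic) * g)) := by
    intro g
    rw [eisensteinSeriesU_eq_tsum_arithmeticBorelQuot hf g, ← tsum_mul_right]
    exact tsum_congr fun q => by rw [hΛG]
  have hptX : ∀ x : (quasiSplit F E c N).automorphicQuotient,
      (quasiSplit F E c N).quotFun (eisensteinSeriesU f) x * conj ((quasiSplit F E c N).quotFun Λ' x) =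
        ∑' q : Quotient (QuotientGroup.rightRel (arithmeticBorel F E c N)),
          f (((q.out : (quasiSplit F E c N).arithmeticSubgroup) : (quasiSplit F E c N).Adelic) * (Quotient.out x : (quasiSplit F E c N).Adelic)⁻¹) *
            conj (Λ' (((q.out : (quasiSplit F E c N).arithmeticSubgroup) : (quasiSplit F E c N).Adelic) * (Quotient.out x : (quasiSplit F E c N).Adelic)⁻¹)) :=
    fun x => hpt _
  refine ⟨hI.congr (ae_of_all _ fun x => (hptX x).symm), ?_⟩
  rw [integral_congr_ae (ae_of_all _ hptX), hE]

end Unfold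

end Summit.HodgeConjecture.HodgeConjecture.Cruxes.H413.K2E1PseudoEisensteinRadialCMTwo

end
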